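import Literature.NumberTheory.Sieve.RankinSmoothBound
import Literature.NumberTheory.LFunctions.MertensSecondLogPower
import Literature.NumberTheory.Sieve.SmoothNumbersLHalfAnalytic
import Mathlib.Analysis.SpecialFunctions.Pow.Real
import Mathlib.Analysis.SpecialFunctions.Sqrt
import HarnessLib

/-!
# Smooth numbers in the `L[1/2]` range, upper bound by Rankin's method (explicit form)

The companion of `SmoothNumbersLowerBoundLHalf.lean`: by Rankin's method
(`Literature.NumberTheory.Sieve.card_smoothNumbersUpTo_le_rankin`, `Ψ(N, k) ≤ N^σ ∏_{p<k}(1 − p^{−σ})⁻¹`)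
with `σ = 1 − (log u)/log y`, `u = log x/log y`, the crude Euler-product bound
`(1 − v)⁻¹ ≤ e^{4v}` (`inv_one_sub_le_exp_four_mul`) and Mertens' theorem split at `√y`
(`∑_{p ≤ √y} p^{−σ} ≤ √u (log log y + 4)`, `∑_{√y < p ≤ y} p^{−σ} ≤ u (log 2 + O(1/log y))`):

* `card_smoothNumbersUpTo_le_rpow_mul_exp` — the explicit bound
  `Ψ(x, y+1) ≤ x^{1 − log u/log y} · exp(4 (√u (log log y + 4) + u (log 2 + 3K/log y)))` for
  `y ≥ 4`, `1 ≤ u ≤ √y`, where `K` is the constant of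
  `Literature.NumberTheory.LFunctions.Mertens.abs_sum_primesLE_inv_sub_loglog_le 1`;
* (in the sequel `SmoothNumbersUpperBoundLHalf.lean`) `card_smoothNumbersUpTo_le_LHalf` — for
  `β, ε > 0`, eventually in `x`, for all `y ≤ exp(β √(log x log log x))`:
  `Ψ(x, y+1) ≤ x · exp(−(1/(2β) − ε) √(log x · log log x))`.

Together with `card_smoothNumbersUpTo_ge_LHalf` this is `ψ(x, L_x[1/2, β]) = x · L_x[1/2, −1/(2β) + o(1)]`
(Canfield–Erdős–Pomerance 1983 in the `L[1/2]` range; de Bruijn 1966 for the upper bound), the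
two-sided estimate on which every `L[1/2]` running-time analysis rests (random squares, the class
group relations method of Lenstra–Pomerance 1992 §10–§11). Everything is proved; no named facts.

## References

* N. G. de Bruijn, *On the number of positive integers `≤ x` and free of prime factors `> y`. II*,
  Indag. Math. 28 (1966) 239–247 (Rankin's method upper bound).
* E. R. Canfield, P. Erdős, C. Pomerance, J. Number Theory 17 (1983) 1–28.
* H. W. Lenstra Jr., C. Pomerance, J. Amer. Math. Soc. 5 (1992) 483–516, §10 (proof of Thm 10.3,
  "the probability … is `L[½, −½ + o(1)]`"). [LenstraPomerance1992]
* H. L. Montgomery, R. C. Vaughan, *Multiplicative Number Theory I*, §7.1 (7.17). [MontgomeryVaughan2007]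
-/

noncomputable section

namespace Literature.NumberTheory.Sieve

open Finset Real Filter

namespace LHalfUpper

/-! ### Elementary facts about `p^{-σ}` -/

/-- For `p ≥ 2` and `σ ≥ 1/2`: `0 ≤ p^{-σ} ≤ 3/4` (as `2^{-1/2} = 1/√2 ≤ 3/4`; the last step is
also `Literature.NumberTheory.LFunctions.PartialEuler.two_rpow_neg_half_le`, not imported here to
keep this file light). [folklore] -/
theorem rpow_neg_le_three_quarters {p σ : ℝ} (hp : 2 ≤ p) (hσ : 1 / 2 ≤ σ) :
    0 ≤ p ^ (-σ) ∧ p ^ (-σ) ≤ 3 / 4 := by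
  refine ⟨Real.rpow_nonneg (by linarith) _, ?_⟩
  have hlast : (2 : ℝ) ^ (-(1 / 2 : ℝ)) ≤ 3 / 4 := by
    rw [Real.rpow_neg (by norm_num), ← Real.sqrt_eq_rpow]
    have h : (4 / 3 : ℝ) ≤ Real.sqrt 2 := by
      rw [Real.le_sqrt (by norm_num) (by norm_num)]; norm_num
    have h0 : (0 : ℝ) < Real.sqrt 2 := by positivity
    rw [inv_le_comm₀ h0 (by norm_num)]
    linarith
  calc p ^ (-σ) ≤ (2 : ℝ) ^ (-σ) :=
        Real.rpow_le_rpow_of_nonpos (by norm_num) hp (by linarith)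
    _ ≤ (2 : ℝ) ^ (-(1 / 2 : ℝ)) := Real.rpow_le_rpow_of_exponent_le (by norm_num) (by linarith)
    _ ≤ 3 / 4 := hlast

/-- `p^{-σ} = p⁻¹ · p^{1-σ}` and `p^{1-σ} ≤ exp M` when `(1 - σ) log p ≤ M` (`p > 0`). [folklore] -/
theorem rpow_neg_le_inv_mul_exp {p σ M : ℝ} (hp : 0 < p) (h : (1 - σ) * Real.log p ≤ M) :
    p ^ (-σ) ≤ p⁻¹ * Real.exp M := by
  have e : p ^ (-σ) = p⁻¹ * p ^ (1 - σ) := by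
    rw [← Real.rpow_neg_one, ← Real.rpow_add hp]; ring_nf
  rw [e]
  refine mul_le_mul_of_nonneg_left ?_ (inv_nonneg.2 hp.le)
  rw [Real.rpow_def_of_pos hp, mul_comm]
  exact Real.exp_le_exp.2 h

/-! ### The prime sum `∑_{p ≤ y} p^{-σ}`, split at `√y` -/

/-- **`∑_{p ≤ y} p^{−σ} ≤ √u (log log y + 4) + u (log 2 + 3K/log y)`** for `σ = 1 − log u/log y`,
`y ≥ 4`, `u ≥ 1`: the primes `p ≤ √y` have `p^{1−σ} ≤ √u` (elementary Mertens
`∑_{p ≤ √y} 1/p ≤ log log y + 4`), the primes `√y < p ≤ y` have `p^{1−σ} ≤ u` and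
`∑_{√y < p ≤ y} 1/p ≤ log 2 + 3K/log y` (Mertens' second theorem with rate, constant `K`).
[folklore] -/
theorem sum_primesLE_rpow_neg_le {Y : ℕ} (hY : 4 ≤ Y) {u : ℝ} (hu : 1 ≤ u) {K : ℝ}
    (hK : ∀ t : ℝ, 2 ≤ t →
      |(∑ p ∈ Nat.primesLE ⌊t⌋₊, (p : ℝ)⁻¹) -
          (Real.log (Real.log t) + Literature.NumberTheory.LFunctions.Mertens.meisselMertens)| ≤
        K / Real.log t ^ 1) :
    ∑ p ∈ Nat.primesLE Y, (p : ℝ) ^ (-(1 - Real.log u / Real.log Y)) ≤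
      Real.sqrt u * (Real.log (Real.log Y) + 4) + u * (Real.log 2 + 3 * K / Real.log Y) := by
  set σ : ℝ := 1 - Real.log u / Real.log Y with hσ
  set M := Literature.NumberTheory.LFunctions.Mertens.meisselMertens with hM
  have hY' : (4 : ℝ) ≤ Y := by exact_mod_cast hY
  have hY0 : (0 : ℝ) < Y := by linarith
  have hlogY : 0 < Real.log Y := Real.log_pos (by linarith)
  have hu0 : 0 < u := by linarith
  have hlogu : 0 ≤ Real.log u := Real.log_nonneg hu
  have hcoef : 0 ≤ Real.log u / Real.log Y := div_nonneg hlogu hlogY.le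
  have h1σ : 1 - σ = Real.log u / Real.log Y := by rw [hσ]; ring
  -- `R = ⌊√Y⌋`, `2 ≤ R`, `R ≤ √Y ≤ Y`
  set R : ℕ := ⌊Real.sqrt Y⌋₊ with hR
  have hsqrtY : 2 ≤ Real.sqrt Y := by
    rw [show (2 : ℝ) = Real.sqrt 4 by
      rw [show (4 : ℝ) = 2 ^ 2 by norm_num, Real.sqrt_sq (by norm_num)]]
    exact Real.sqrt_le_sqrt hY'
  have hR2 : 2 ≤ R := Nat.le_floor (by exact_mod_cast hsqrtY)
  have hRle : (R : ℝ) ≤ Real.sqrt Y := Nat.floor_le (by positivity)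
  have hsqrt_le : Real.sqrt Y ≤ Y := by
    have h : Real.sqrt Y ≤ Real.sqrt ((Y : ℝ) ^ 2) := Real.sqrt_le_sqrt (by nlinarith)
    rwa [Real.sqrt_sq hY0.le] at h
  have hRY : R ≤ Y := by exact_mod_cast hRle.trans hsqrt_le
  have hR0 : (0 : ℝ) < R := by exact_mod_cast (show 0 < R by omega)
  have hlogsqrt : Real.log (Real.sqrt Y) = Real.log Y / 2 := Real.log_sqrt hY0.le
  -- the filter `p ≤ R` of `primesLE Y` is `primesLE R`
  have hfilt : (Nat.primesLE Y).filter (fun p => p ≤ R) = Nat.primesLE R := by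
    ext p
    simp only [mem_filter, Nat.mem_primesLE]
    constructor
    · rintro ⟨⟨-, hp⟩, hpR⟩; exact ⟨hpR, hp⟩
    · rintro ⟨hpR, hp⟩; exact ⟨⟨hpR.trans hRY, hp⟩, hpR⟩
  -- pointwise bounds
  have hlow : ∀ p ∈ (Nat.primesLE Y).filter (fun p => p ≤ R),
      (p : ℝ) ^ (-σ) ≤ (p : ℝ)⁻¹ * Real.sqrt u := by
    intro p hp
    obtain ⟨hpY, hpR⟩ := mem_filter.1 hp
    have hpp := Nat.prime_of_mem_primesLE hpY
    have hp0 : (0 : ℝ) < p := by exact_mod_cast hpp.pos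
    have hlogp : Real.log p ≤ Real.log Y / 2 := by
      rw [← hlogsqrt]
      exact Real.log_le_log hp0 ((show (p : ℝ) ≤ R by exact_mod_cast hpR).trans hRle)
    have h := rpow_neg_le_inv_mul_exp (σ := σ) hp0 (M := Real.log u / 2) (by
      rw [h1σ]
      calc Real.log u / Real.log Y * Real.log p ≤ Real.log u / Real.log Y * (Real.log Y / 2) :=
            mul_le_mul_of_nonneg_left hlogp hcoef
        _ = Real.log u / 2 := by field_simp)
    rwa [show Real.exp (Real.log u / 2) = Real.sqrt u by
      rw [Real.sqrt_eq_rpow, Real.rpow_def_of_pos hu0]; ring_nf] at h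
  have hhigh : ∀ p ∈ (Nat.primesLE Y).filter (fun p => ¬ p ≤ R),
      (p : ℝ) ^ (-σ) ≤ (p : ℝ)⁻¹ * u := by
    intro p hp
    obtain ⟨hpY, -⟩ := mem_filter.1 hp
    have hpp := Nat.prime_of_mem_primesLE hpY
    have hp0 : (0 : ℝ) < p := by exact_mod_cast hpp.pos
    have hlogp : Real.log p ≤ Real.log Y :=
      Real.log_le_log hp0 (by exact_mod_cast Nat.le_of_mem_primesLE hpY)
    have h := rpow_neg_le_inv_mul_exp (σ := σ) hp0 (M := Real.log u) (by
      rw [h1σ]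
      calc Real.log u / Real.log Y * Real.log p ≤ Real.log u / Real.log Y * Real.log Y :=
            mul_le_mul_of_nonneg_left hlogp hcoef
        _ = Real.log u := by field_simp)
    rwa [Real.exp_log hu0] at h
  -- the two Mertens inputs
  have hsmall : ∑ p ∈ Nat.primesLE R, (p : ℝ)⁻¹ ≤ Real.log (Real.log Y) + 4 := by
    have h1 := Literature.NumberTheory.LFunctions.MertensBound.sum_inv_prime_le R hR2
    simp only [one_div] at h1
    have h2 : Real.log (Real.log R) ≤ Real.log (Real.log Y) := by
      have hR2' : (2 : ℝ) ≤ R := by exact_mod_cast hR2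
      exact Real.log_le_log (Real.log_pos (by linarith))
        (Real.log_le_log hR0 (by exact_mod_cast hRY))
    linarith
  have htop : ∑ p ∈ (Nat.primesLE Y).filter (fun p => ¬ p ≤ R), (p : ℝ)⁻¹ ≤
      Real.log 2 + 3 * K / Real.log Y := by
    have hsplit := sum_filter_add_sum_filter_not (Nat.primesLE Y) (fun p => p ≤ R)
      (fun p => (p : ℝ)⁻¹)
    rw [hfilt] at hsplit
    -- upper bound for the full sum, lower bound for the small primes
    have hfull := hK Y (by linarith)
    rw [Nat.floor_natCast, pow_one] at hfull
    have hlowK := hK (Real.sqrt Y) hsqrtY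
    rw [← hR, pow_one, hlogsqrt, Real.log_div hlogY.ne' two_ne_zero] at hlowK
    have h1 := (abs_le.1 hfull).2
    have h2 := (abs_le.1 hlowK).1
    have e : K / (Real.log ↑Y / 2) = 2 * K / Real.log Y := by field_simp
    rw [e] at h2
    have e2 : 3 * K / Real.log Y = K / Real.log Y + 2 * K / Real.log Y := by ring
    linarith
  -- assemble
  rw [← sum_filter_add_sum_filter_not (Nat.primesLE Y) (fun p => p ≤ R)]
  have hA : ∑ p ∈ (Nat.primesLE Y).filter (fun p => p ≤ R), (p : ℝ) ^ (-σ) ≤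
      Real.sqrt u * (Real.log (Real.log Y) + 4) := by
    calc ∑ p ∈ (Nat.primesLE Y).filter (fun p => p ≤ R), (p : ℝ) ^ (-σ)
        ≤ ∑ p ∈ (Nat.primesLE Y).filter (fun p => p ≤ R), (p : ℝ)⁻¹ * Real.sqrt u := sum_le_sum hlow
      _ = Real.sqrt u * ∑ p ∈ Nat.primesLE R, (p : ℝ)⁻¹ := by rw [← sum_mul, hfilt, mul_comm]
      _ ≤ Real.sqrt u * (Real.log (Real.log Y) + 4) :=
          mul_le_mul_of_nonneg_left hsmall (Real.sqrt_nonneg u)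
  have hB : ∑ p ∈ (Nat.primesLE Y).filter (fun p => ¬ p ≤ R), (p : ℝ) ^ (-σ) ≤
      u * (Real.log 2 + 3 * K / Real.log Y) := by
    calc ∑ p ∈ (Nat.primesLE Y).filter (fun p => ¬ p ≤ R), (p : ℝ) ^ (-σ)
        ≤ ∑ p ∈ (Nat.primesLE Y).filter (fun p => ¬ p ≤ R), (p : ℝ)⁻¹ * u := sum_le_sum hhigh
      _ = u * ∑ p ∈ (Nat.primesLE Y).filter (fun p => ¬ p ≤ R), (p : ℝ)⁻¹ := by
          rw [← sum_mul, mul_comm]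
      _ ≤ u * (Real.log 2 + 3 * K / Real.log Y) := mul_le_mul_of_nonneg_left htop hu0.le
  linarith

/-! ### The explicit Rankin bound -/

/-- **Explicit upper bound by Rankin's method.** For `y ≥ 4` and `1 ≤ u` with `log u ≤ (log y)/2`
(i.e. `u ≤ √y`), with `σ = 1 − log u/log y ∈ [1/2, 1]`:
`Ψ(x, y+1) ≤ x^σ · exp(4 (√u (log log y + 4) + u (log 2 + 3K/log y)))`, `K` the constant of
Mertens' second theorem with rate `1/log`. (Rankin: `Ψ ≤ x^σ ∏_{p ≤ y} (1 − p^{−σ})⁻¹`, and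
`(1 − p^{−σ})⁻¹ ≤ exp(4 p^{−σ})` as `p^{−σ} ≤ 2^{−1/2} ≤ 3/4`.)
[cite: LenstraPomerance1992, §10 proof of Thm 10.3] -/
theorem card_smoothNumbersUpTo_le_rpow_mul_exp (x : ℕ) {Y : ℕ} (hY : 4 ≤ Y) {u : ℝ} (hu : 1 ≤ u)
    (huY : Real.log u ≤ Real.log Y / 2) {K : ℝ}
    (hK : ∀ t : ℝ, 2 ≤ t →
      |(∑ p ∈ Nat.primesLE ⌊t⌋₊, (p : ℝ)⁻¹) -
          (Real.log (Real.log t) + Literature.NumberTheory.LFunctions.Mertens.meisselMertens)| ≤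
        K / Real.log t ^ 1) :
    ((Nat.smoothNumbersUpTo x (Y + 1)).card : ℝ) ≤
      (x : ℝ) ^ (1 - Real.log u / Real.log Y) *
        Real.exp (4 * (Real.sqrt u * (Real.log (Real.log Y) + 4) + u * (Real.log 2 + 3 * K / Real.log Y))) := by
  set σ : ℝ := 1 - Real.log u / Real.log Y with hσ
  have hY' : (4 : ℝ) ≤ Y := by exact_mod_cast hY
  have hlogY : 0 < Real.log Y := Real.log_pos (by linarith)
  have hlogu : 0 ≤ Real.log u := Real.log_nonneg hu
  have hσhalf : 1 / 2 ≤ σ := by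
    have h : Real.log u / Real.log Y ≤ 1 / 2 := by
      rw [div_le_iff₀ hlogY]; linarith
    rw [hσ]; linarith
  have hσpos : 0 < σ := by linarith
  have hR := card_smoothNumbersUpTo_le_rankin x (Y + 1) hσpos
  have hPB : (Y + 1).primesBelow = Nat.primesLE Y := rfl
  rw [hPB] at hR
  refine hR.trans (mul_le_mul_of_nonneg_left ?_ (by positivity))
  -- the Euler product
  have hfac : ∀ p ∈ Nat.primesLE Y, (1 - (p : ℝ) ^ (-σ))⁻¹ ≤ Real.exp (4 * (p : ℝ) ^ (-σ)) := by
    intro p hp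
    have hp2 : (2 : ℝ) ≤ p := by exact_mod_cast (Nat.prime_of_mem_primesLE hp).two_le
    obtain ⟨h0, h34⟩ := rpow_neg_le_three_quarters hp2 hσhalf
    exact inv_one_sub_le_exp_four_mul h0 h34
  have hfac0 : ∀ p ∈ Nat.primesLE Y, 0 ≤ (1 - (p : ℝ) ^ (-σ))⁻¹ := by
    intro p hp
    have hp2 : (2 : ℝ) ≤ p := by exact_mod_cast (Nat.prime_of_mem_primesLE hp).two_le
    obtain ⟨-, h34⟩ := rpow_neg_le_three_quarters hp2 hσhalf
    exact inv_nonneg.2 (by linarith)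
  calc ∏ p ∈ Nat.primesLE Y, (1 - (p : ℝ) ^ (-σ))⁻¹
      ≤ ∏ p ∈ Nat.primesLE Y, Real.exp (4 * (p : ℝ) ^ (-σ)) := prod_le_prod hfac0 hfac
    _ = Real.exp (4 * ∑ p ∈ Nat.primesLE Y, (p : ℝ) ^ (-σ)) := by
        rw [← Real.exp_sum, mul_sum]
    _ ≤ _ := Real.exp_le_exp.2 (mul_le_mul_of_nonneg_left
        (sum_primesLE_rpow_neg_le hY hu hK) (by norm_num))

end LHalfUpper

end Literature.NumberTheory.Sieve

end
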